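import Summits.CriticalPhenomena.Ising3DConformalLimit.Theses.MoebiusRestrictionCurrents
import Summits.CriticalPhenomena.Ising3DConformalLimit.Theorems.MoebiusRestrictionCurrentsTargetSuffices
import Summits.CriticalPhenomena.Ising3DConformalLimit.Theorems.MoebiusRestrictionCurrentsFreeIsCritical

/-!
# Birth skeleton (BC3) for crux `TwoPointDomainTheory` (item stmt-CriticalPhenomena-4856)

Route `route-CriticalPhenomena-MoebiusRestrictionCurrents` (sub-problem `Ising3DConformalLimit`), crux r4
`Summit.CriticalPhenomena.Ising3DConformalLimit.Theses.MoebiusRestrictionCurrents.TwoPointDomainTheory`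
(TWO-POINT DOMAIN THEORY, existence half, `n = 2`): `∃ Δ > 0, ∃ H` with `ρ₀(δ)² G^D_δ(x,y) → H_D(x,y)`
locally uniformly on `x ≠ y ∈ D` for every admissible `D`, `H_{ℝ³} > 0`, and covariance of `(D,x,y) ↦ H_D(x,y)`
under translations, `O(3)` and dilations (factor `c^{-2Δ}`).

## The line: BULK POWER LAW × DIMENSIONLESS REMOVAL RATIO

The restriction philosophy of the route (crux r3 `RemovalRatioInversion` is stated on the ρ-free, Δ-free removal
ratios `G^D_δ/G^{ℝ³}_δ`) suggests cutting the crux along the seam BULK / BOUNDARY: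

* `stub_bulkPowerLaw` — the FULL-SPACE half: in canonical units the critical two-point function of `ℤ³` has the
  isotropic pure-power scaling limit `‖x − y‖^{-2Δ}` for some `Δ > 0`, locally uniformly off the diagonal
  ("`η(3)` exists" + rotational invariance; = the shared open cruxes stmt-CriticalPhenomena-0635 / 0634 of this
  sub-problem in canonical form — it follows from item 0634 by the landed lemmas
  `Theorems.MoebiusLimitOfTwoPointLaw.Negative.tendstoLocallyUniformlyOn_arity_two_of_twoPointLaw`,
  `Negative.twoPointLaw_along_mesh` (canonical ratio) and `Literature…twoPointLaw_exponent_pos`).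
* `stub_removalRatio` — the DOMAIN half, dimensionless: for every admissible `D` the removal ratios
  `G^D_δ(x,y)/G^{ℝ³}_δ(x,y)` converge locally uniformly on `x ≠ y ∈ D` to a kernel `r_D(x,y) ∈ [0,1]`
  (GKS: removing couplings lowers free correlations) that is INVARIANT under translations, `O(3)` and dilations
  of `(D,x,y)` — no `Δ`, no `ρ`: the whole anomalous dimension sits in the bulk factor. In the restriction
  dictionary `r_D(x,y) = E^{xy}[e^{-𝓘(K,Dᶜ)}; K ⊂ D]` is the defect-weighted avoidance functional of the
  backbone, a scale-invariant scalar; it is the Euclidean/scale counterpart of crux r3 (inversion).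
* `twoPointDomainTheory_of_bulk_of_ratio : stub₁-sig → stub₂-sig → crux (unfolded)` — the sorry-free assembly, and
  `TwoPointDomainTheory_of : crux` BY NAME (= assembly applied to the two stubs; the skeleton theorem of
  `#h21_check_skeleton`). Witness `H_D(x,y) := ‖x − y‖^{-2Δ} · r_D(x,y)`. Convergence in
  `D` is the product of the two locally uniform limits (bulk limit continuous, ratio limit bounded by `1`;
  `TendstoLocallyUniformlyOn.mul₀_of_isBoundedUnder`) after the identity
  `ρ₀² G^D_δ = (ρ₀² G^{ℝ³}_δ) · (G^D_δ / G^{ℝ³}_δ)`, valid for `δ > 0` because `G^{ℝ³}_δ = criticalCorr 3 > 0`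
  (landed `FreeIsCritical` + `limUnder_eq_criticalCorr` + `criticalTwoPoint_pos3`); `r_{ℝ³} = 1` by uniqueness of
  locally uniform limits, whence `H_{ℝ³} = ‖x − y‖^{-2Δ} > 0`; translation / isometry covariance from
  `‖(x+v) − (y+v)‖ = ‖x − y‖ = ‖Rx − Ry‖` and the invariances of `r`; the dilation factor `c^{-2Δ}` comes from
  the power law alone (`‖c(x − y)‖^{-2Δ} = c^{-2Δ}‖x − y‖^{-2Δ}`), which is exactly why `r` must be scale-INVARIANT.

Disproof used: none — no `Disproof.lean` exists for this crux yet (`ledger crux ls stmt-CriticalPhenomena-4856`: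
no workfiles, 2026-08-17). Negatives index: no refuted statement of the summit concerns domain two-point limits.

BC3 probes (separate files `bc/probe_*.lean`, defs only, no stubs in scope): for each stub,
`stub → TwoPointDomainTheory` and `stub → Ising3DConformalLimit` by `first | exact? | simpa | aesop` FAIL.
-/

noncomputable section

namespace Summit.CriticalPhenomena.Ising3DConformalLimit.Cruxes.TwoPointDomainTheory.Birth

open scoped Classical
open Literature.Probability.LatticeModels Filter Topology MeasureTheory
open Summit.CriticalPhenomena.Ising3DConformalLimit.Theorems (freeIsCritical_proof)
open Summit.CriticalPhenomena.Ising3DConformalLimit.Theorems.MoebiusRestrictionCurrentsTargetSuffices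
  (limUnder_eq_criticalCorr adm_univ)
open Summit.CriticalPhenomena.Ising3DConformalLimit.PinnedClusterPoints (criticalTwoPoint_pos3)

/-! ## Objects (verbatim the `let`s `G`, `ρ₀` of the crux; its `Adm D` is inlined as `IsOpen D ∧ volume (frontier D) = 0`) -/

/-- The route's discretised free-b.c. critical correlator of the domain `D` at mesh `δ` (verbatim the route's
`G`): the box limit of `⟨∏σ_{[xᵢ/δ]}⟩^free` of the sub-lattice `{z ∈ ℤ³ : z ∈ [D/δ]}`. -/
def G (D : Set (EuclideanSpace ℝ (Fin 3))) (δ : ℝ) (n : ℕ) (x : Fin n → EuclideanSpace ℝ (Fin 3)) : ℝ :=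
  limUnder Filter.atTop (fun Lb : ℕ => Literature.Probability.LatticeModels.isingExpect (Literature.Probability.LatticeModels.zdGraph 3) ((Literature.Probability.LatticeModels.box 3 Lb).filter (fun z => z ∈ Literature.Probability.LatticeModels.latticeApprox δ '' D)) (Literature.Probability.LatticeModels.criticalBeta 3) 0 Literature.Probability.LatticeModels.BoundaryCondition.free (Literature.Probability.LatticeModels.spinMonomial (fun i => Literature.Probability.LatticeModels.latticeApprox δ (x i))))

/-- The canonical renormalisation `ρ₀(δ) = ⟨σ₀σ_{[e₁/δ]}⟩_{β_c}^{-1/2}` (verbatim the route's `ρ₀`). -/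
def ρ₀ (δ : ℝ) : ℝ :=
  (Real.sqrt (Literature.Probability.LatticeModels.criticalTwoPoint 3 (Literature.Probability.LatticeModels.latticeApprox δ (EuclideanSpace.single (0 : Fin 3) (1 : ℝ)))))⁻¹

/-- The route decl, unfolded: its three `let`s are `Adm D := IsOpen D ∧ volume (frontier D) = 0` (inlined below)
and the two definitions `G`, `ρ₀` above (pure `Iff.rfl`). -/
theorem crux_iff :
    Summit.CriticalPhenomena.Ising3DConformalLimit.Theses.MoebiusRestrictionCurrents.TwoPointDomainTheory ↔
  ∃ (Δ : ℝ) (H : Set (EuclideanSpace ℝ (Fin 3)) → EuclideanSpace ℝ (Fin 3) → EuclideanSpace ℝ (Fin 3) → ℝ), 0 < Δ ∧ (∀ D : Set (EuclideanSpace ℝ (Fin 3)), IsOpen D ∧ MeasureTheory.volume (frontier D) = 0 → TendstoLocallyUniformlyOn (fun (δ : ℝ) (x : Fin 2 → EuclideanSpace ℝ (Fin 3)) => ρ₀ δ ^ 2 * G D δ 2 x) (fun x => H D (x 0) (x 1)) (nhdsWithin (0 : ℝ) (Set.Ioi 0)) (Literature.Probability.LatticeModels.NonCoincident 3 2 ∩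 {x | ∀ i, x i ∈ D})) ∧ (∀ x y : EuclideanSpace ℝ (Fin 3), x ≠ y → 0 < H Set.univ x y) ∧ (∀ D : Set (EuclideanSpace ℝ (Fin 3)), IsOpen D ∧ MeasureTheory.volume (frontier D) = 0 → ∀ (v x y : EuclideanSpace ℝ (Fin 3)), x ∈ D → y ∈ D → x ≠ y → H ((fun z => z + v) '' D) (x + v) (y + v) = H D x y) ∧ (∀ D : Set (EuclideanSpace ℝ (Fin 3)), IsOpen D ∧ MeasureTheory.volume (frontier D) = 0 → ∀ (R : EuclideanSpace ℝ (Fin 3) ≃ₗᵢ[ℝ] EuclideanSpace ℝ (Fin 3)) (x y : EuclideanSpace ℝ (Fin 3)), x ∈ D → y ∈ D → x ≠ y → H (R '' D) (R x) (R y) = H D x y) ∧ (∀ D : Set (EuclideanSpace ℝ (Fin 3)), IsOpen D ∧ MeasureTheory.volume (frontier D) = 0 → ∀ (c : ℝ), 0 < c → ∀ (x y : EuclideanSpace ℝ (Fin 3)), x ∈ D → y ∈ D → x ≠ y → H ((fun z => c • z) '' D) (c • x) (c • y) = c ^ (-(2 : ℝ) * Δ) * H D x y) :=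
  Iff.rfl

/-! ## The two stubs -/

/-- **Stub 1 — BULK TWO-POINT POWER LAW in canonical units (the full-space half).** There is `Δ > 0` such that
`ρ₀(δ)² ⟨σ_{[x/δ]}σ_{[y/δ]}⟩⁺_{β_c} → ‖x − y‖^{-2Δ}` as `δ → 0⁺`, locally uniformly on `x ≠ y` (`ρ₀` canonical, so
the limit is `1` at `‖x − y‖ = 1`). Informally: `η(3)` exists AND the full-space two-point scaling limit is the
isotropic pure power law. This is the conjunction of the shared open cruxes stmt-CriticalPhenomena-0635 (`η`
exists) and stmt-CriticalPhenomena-0634 (isotropic pure power law) of the sub-problem, in canonical form; it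
FOLLOWS from item 0634 (glue ≈ 100 lines over the landed `Negative.TwoPointConvergence` / `Negative.CanonicalForm`
lemmas), so it is staffed there, not here. Why it might fail / status: open (Duminil-Copin ICM 2022 §8.4);
rigorously only `c‖x‖⁻² ≤ ⟨σ₀σ_x⟩ ≤ C‖x‖⁻¹` (`criticalTwoPoint_bounds_holds`) and `η ≤ 1/2` IF it exists
(Duminil-Copin–Panis arXiv:2404.05700 Thm 1.5); rotational invariance of the limit has no tool on `ℤ³`.
Size: open-problem. [DuminilCopinICM2022 §8.4; DuminilCopinPanis2025LowerBounds Thm 1.5] -/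
theorem stub_bulkPowerLaw :
    ∃ Δ : ℝ, 0 < Δ ∧
      TendstoLocallyUniformlyOn (rescaledCorrelator (criticalCorr 3) ρ₀ 2)
        (fun x : Fin 2 → EuclideanSpace ℝ (Fin 3) => ‖x 0 - x 1‖ ^ (-(2 * Δ)))
        (nhdsWithin (0 : ℝ) (Set.Ioi 0)) (NonCoincident 3 2) := by
  sorry

/-- **Stub 2 — REMOVAL-RATIO THEORY (the domain half; dimensionless: no `Δ`, no `ρ`).** There is a kernel
`r : (domains) → ℝ³ → ℝ³ → ℝ` such that for every admissible `D` the removal ratios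
`G^D_δ(x,y) / G^{ℝ³}_δ(x,y)` (free-b.c. critical pair correlator of the discretised domain over the full-space
one) converge to `r_D(x,y)` as `δ → 0⁺`, locally uniformly on `x ≠ y ∈ D`; `0 ≤ r_D ≤ 1` (GKS: removing the
couplings outside `D` lowers free correlations, `isingCorr_free_le_of_subset`); and `(D,x,y) ↦ r_D(x,y)` is
INVARIANT under translations, linear isometries and dilations `z ↦ cz`, `c > 0`. In the restriction dictionary
`r_D(x,y)` is the defect-weighted probability that the random-current backbone from `x` to `y` avoids `Dᶜ` — a
conformally invariant scalar of the continuum theory (boundary CFT of the free = 'ordinary' surface); this stub is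
the Euclidean/scale counterpart of crux r3 `RemovalRatioInversion` (inversion) and carries the whole DOMAIN
content of the crux. Why it might fail: existence of boundary two-point limits for EVERY admissible `D` (tilted
staircases, cusps, Lebesgue-null fractal frontiers; the scheme `[D/δ]` is blind to null cracks) has no rigorous
tool in 3D, and scale invariance of `r` needs the free lattice surface of every such `D` to flow to ONE
scale-invariant boundary condition. Size: open-problem (2D analogue: Chelkak–Hongler–Izyurov arXiv:2103.10263
Thm 1.3). [Cardy1996; CosmeLopesPenedones2015 §3–4; BurkhardtEisenriegler1995; AizenmanCMP1982 §9;
DuminilCopinICM2022 §8.1 (8.1)/(8.3)] -/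
theorem stub_removalRatio :
    ∃ r : Set (EuclideanSpace ℝ (Fin 3)) → EuclideanSpace ℝ (Fin 3) → EuclideanSpace ℝ (Fin 3) → ℝ,
      (∀ D : Set (EuclideanSpace ℝ (Fin 3)), IsOpen D ∧ MeasureTheory.volume (frontier D) = 0 →
        TendstoLocallyUniformlyOn
          (fun (δ : ℝ) (x : Fin 2 → EuclideanSpace ℝ (Fin 3)) => G D δ 2 x / G Set.univ δ 2 x)
          (fun x => r D (x 0) (x 1)) (nhdsWithin (0 : ℝ) (Set.Ioi 0))
          (NonCoincident 3 2 ∩ {x | ∀ i, x i ∈ D})) ∧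
      (∀ D : Set (EuclideanSpace ℝ (Fin 3)), IsOpen D ∧ MeasureTheory.volume (frontier D) = 0 → ∀ x y : EuclideanSpace ℝ (Fin 3),
        0 ≤ r D x y ∧ r D x y ≤ 1) ∧
      (∀ D : Set (EuclideanSpace ℝ (Fin 3)), IsOpen D ∧ MeasureTheory.volume (frontier D) = 0 → ∀ (v x y : EuclideanSpace ℝ (Fin 3)),
        x ∈ D → y ∈ D → x ≠ y → r ((fun z => z + v) '' D) (x + v) (y + v) = r D x y) ∧
      (∀ D : Set (EuclideanSpace ℝ (Fin 3)), IsOpen D ∧ MeasureTheory.volume (frontier D) = 0 →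
        ∀ (R : EuclideanSpace ℝ (Fin 3) ≃ₗᵢ[ℝ] EuclideanSpace ℝ (Fin 3)) (x y : EuclideanSpace ℝ (Fin 3)),
        x ∈ D → y ∈ D → x ≠ y → r (R '' D) (R x) (R y) = r D x y) ∧
      (∀ D : Set (EuclideanSpace ℝ (Fin 3)), IsOpen D ∧ MeasureTheory.volume (frontier D) = 0 → ∀ (c : ℝ), 0 < c → ∀ (x y : EuclideanSpace ℝ (Fin 3)),
        x ∈ D → y ∈ D → x ≠ y → r ((fun z => c • z) '' D) (c • x) (c • y) = r D x y) := by
  sorry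

/-! ## Proved glue -/

/-- A non-coincident pair has distinct entries. -/
theorem ne_of_mem_nonCoincident {x : Fin 2 → EuclideanSpace ℝ (Fin 3)} (hx : x ∈ NonCoincident 3 2) :
    x 0 ≠ x 1 := fun h => absurd ((mem_nonCoincident x).1 hx h) (by decide)

/-- A pair of distinct points is a non-coincident configuration. -/
theorem pair_mem_nonCoincident {x y : EuclideanSpace ℝ (Fin 3)} (h : x ≠ y) :
    (![x, y] : Fin 2 → EuclideanSpace ℝ (Fin 3)) ∈ NonCoincident 3 2 := by
  rw [mem_nonCoincident]
  intro i j hij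
  fin_cases i <;> fin_cases j
  · rfl
  · exact absurd (by simpa using hij) h
  · exact absurd (by simpa using hij.symm) h
  · rfl

/-- For `δ ≠ 0` the full-space member of the route's family IS the critical correlator of `ℤ³` (landed:
`FreeIsCritical` + surjectivity of `[·/δ]`). -/
theorem G_univ_eq {δ : ℝ} (hδ : δ ≠ 0) (n : ℕ) (x : Fin n → EuclideanSpace ℝ (Fin 3)) :
    G Set.univ δ n x = criticalCorr 3 n (fun i => latticeApprox δ (x i)) :=
  limUnder_eq_criticalCorr freeIsCritical_proof hδ (Set.subset_univ _) n x

/-- The full-space pair correlator at positive mesh is positive (`⟨σ_aσ_b⟩_{β_c} > 0` on `ℤ³`). -/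
theorem G_univ_two_pos {δ : ℝ} (hδ : 0 < δ) (x : Fin 2 → EuclideanSpace ℝ (Fin 3)) :
    0 < G Set.univ δ 2 x := by
  rw [G_univ_eq hδ.ne']
  have h : (fun i => latticeApprox δ (x i)) = ![latticeApprox δ (x 0), latticeApprox δ (x 1)] := by
    funext i; fin_cases i <;> rfl
  rw [h, criticalCorr_two_pair]
  exact criticalTwoPoint_pos3 _

/-- The bulk stub in the route's variables: `ρ₀² G^{ℝ³}_δ → ‖x₀ − x₁‖^{-2Δ}` locally uniformly off the
diagonal. -/
theorem bulk_routeForm {Δ : ℝ}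
    (h : TendstoLocallyUniformlyOn (rescaledCorrelator (criticalCorr 3) ρ₀ 2)
      (fun x : Fin 2 → EuclideanSpace ℝ (Fin 3) => ‖x 0 - x 1‖ ^ (-(2 * Δ)))
      (nhdsWithin (0 : ℝ) (Set.Ioi 0)) (NonCoincident 3 2)) :
    TendstoLocallyUniformlyOn (fun (δ : ℝ) (x : Fin 2 → EuclideanSpace ℝ (Fin 3)) => ρ₀ δ ^ 2 * G Set.univ δ 2 x)
      (fun x => ‖x 0 - x 1‖ ^ (-(2 * Δ))) (nhdsWithin (0 : ℝ) (Set.Ioi 0)) (NonCoincident 3 2) := by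
  refine h.congr_inseparable ?_
  filter_upwards [self_mem_nhdsWithin] with δ hδ x _
  refine Inseparable.of_eq ?_
  show rescaledCorrelator (criticalCorr 3) ρ₀ 2 δ x = ρ₀ δ ^ 2 * G Set.univ δ 2 x
  rw [rescaledCorrelator_apply, G_univ_eq (Set.mem_Ioi.1 hδ).ne']

/-- In full space the removal ratio is identically `1` at positive mesh, hence tends to `1`. -/
theorem ratio_univ_tendsto :
    TendstoLocallyUniformlyOn
      (fun (δ : ℝ) (x : Fin 2 → EuclideanSpace ℝ (Fin 3)) => G Set.univ δ 2 x / G Set.univ δ 2 x)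
      (fun _ => (1 : ℝ)) (nhdsWithin (0 : ℝ) (Set.Ioi 0))
      (NonCoincident 3 2 ∩ {x | ∀ i, x i ∈ (Set.univ : Set (EuclideanSpace ℝ (Fin 3)))}) := by
  rw [Metric.tendstoLocallyUniformlyOn_iff]
  intro ε hε x _
  refine ⟨Set.univ, Filter.univ_mem, ?_⟩
  filter_upwards [self_mem_nhdsWithin] with δ hδ y _
  rw [div_self (G_univ_two_pos (Set.mem_Ioi.1 hδ) y).ne', dist_self]
  exact hε

/-- The power law `‖x₀ − x₁‖^{-2Δ}` is continuous off the diagonal. -/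
theorem continuousOn_powerLaw (Δ : ℝ) :
    ContinuousOn (fun x : Fin 2 → EuclideanSpace ℝ (Fin 3) => ‖x 0 - x 1‖ ^ (-(2 * Δ))) (NonCoincident 3 2) := by
  refine ContinuousOn.rpow_const ?_ fun x hx => Or.inl ?_
  · exact ((continuous_apply 0).sub (continuous_apply 1)).norm.continuousOn
  · exact norm_ne_zero_iff.2 (sub_ne_zero.2 (ne_of_mem_nonCoincident hx))

/-! ## The assembly (sorry-free) -/

/-- **Assembly = the BC3 certificate `stub₁-sig → stub₂-sig → crux` (sorry-free; axioms `propext`,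
`Classical.choice`, `Quot.sound` only).** The two stub STATEMENTS (verbatim the signatures of `stub_bulkPowerLaw`,
`stub_removalRatio`), taken as hypotheses, imply the crux — stated here UNFOLDED (the right-hand side of `crux_iff`,
definitionally the route decl; the by-name closure is `TwoPointDomainTheory_of` below, kept hypothesis-free so that
`#h21_check_skeleton` sees exactly one theorem concluding the crux by name). Witness: `H_D(x,y) := ‖x − y‖^{-2Δ} r_D(x,y)`. -/
theorem twoPointDomainTheory_of_bulk_of_ratio
    (h₁ : ∃ Δ : ℝ, 0 < Δ ∧
      TendstoLocallyUniformlyOn (rescaledCorrelator (criticalCorr 3) ρ₀ 2)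
        (fun x : Fin 2 → EuclideanSpace ℝ (Fin 3) => ‖x 0 - x 1‖ ^ (-(2 * Δ)))
        (nhdsWithin (0 : ℝ) (Set.Ioi 0)) (NonCoincident 3 2))
    (h₂ : ∃ r : Set (EuclideanSpace ℝ (Fin 3)) → EuclideanSpace ℝ (Fin 3) → EuclideanSpace ℝ (Fin 3) → ℝ,
      (∀ D : Set (EuclideanSpace ℝ (Fin 3)), IsOpen D ∧ MeasureTheory.volume (frontier D) = 0 →
        TendstoLocallyUniformlyOn
          (fun (δ : ℝ) (x : Fin 2 → EuclideanSpace ℝ (Fin 3)) => G D δ 2 x / G Set.univ δ 2 x)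
          (fun x => r D (x 0) (x 1)) (nhdsWithin (0 : ℝ) (Set.Ioi 0))
          (NonCoincident 3 2 ∩ {x | ∀ i, x i ∈ D})) ∧
      (∀ D : Set (EuclideanSpace ℝ (Fin 3)), IsOpen D ∧ MeasureTheory.volume (frontier D) = 0 → ∀ x y : EuclideanSpace ℝ (Fin 3),
        0 ≤ r D x y ∧ r D x y ≤ 1) ∧
      (∀ D : Set (EuclideanSpace ℝ (Fin 3)), IsOpen D ∧ MeasureTheory.volume (frontier D) = 0 → ∀ (v x y : EuclideanSpace ℝ (Fin 3)),
        x ∈ D → y ∈ D → x ≠ y → r ((fun z => z + v) '' D) (x + v) (y + v) = r D x y) ∧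
      (∀ D : Set (EuclideanSpace ℝ (Fin 3)), IsOpen D ∧ MeasureTheory.volume (frontier D) = 0 →
        ∀ (R : EuclideanSpace ℝ (Fin 3) ≃ₗᵢ[ℝ] EuclideanSpace ℝ (Fin 3)) (x y : EuclideanSpace ℝ (Fin 3)),
        x ∈ D → y ∈ D → x ≠ y → r (R '' D) (R x) (R y) = r D x y) ∧
      (∀ D : Set (EuclideanSpace ℝ (Fin 3)), IsOpen D ∧ MeasureTheory.volume (frontier D) = 0 → ∀ (c : ℝ), 0 < c → ∀ (x y : EuclideanSpace ℝ (Fin 3)),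
        x ∈ D → y ∈ D → x ≠ y → r ((fun z => c • z) '' D) (c • x) (c • y) = r D x y)) :
    ∃ (Δ : ℝ) (H : Set (EuclideanSpace ℝ (Fin 3)) → EuclideanSpace ℝ (Fin 3) → EuclideanSpace ℝ (Fin 3) → ℝ), 0 < Δ ∧ (∀ D : Set (EuclideanSpace ℝ (Fin 3)), IsOpen D ∧ MeasureTheory.volume (frontier D) = 0 → TendstoLocallyUniformlyOn (fun (δ : ℝ) (x : Fin 2 → EuclideanSpace ℝ (Fin 3)) => ρ₀ δ ^ 2 * G D δ 2 x) (fun x => H D (x 0) (x 1)) (nhdsWithin (0 : ℝ) (Set.Ioi 0)) (Literature.Probability.LatticeModels.NonCoincident 3 2 ∩ {x | ∀ i, x i ∈ D})) ∧ (∀ x y : EuclideanSpace ℝ (Fin 3), x ≠ y → 0 < H Set.univ x y) ∧ (∀ D : Set (EuclideanSpace ℝ (Fin 3)), IsOpen D ∧ MeasureTheory.volume (frontier D) = 0 → ∀ (v x y : EuclideanSpace ℝ (Fin 3)), x ∈ D → y ∈ D → x ≠ y → H ((fun z => z + v) '' D) (x + v) (y + v) = H D x y) ∧ (∀ D : Set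 (EuclideanSpace ℝ (Fin 3)), IsOpen D ∧ MeasureTheory.volume (frontier D) = 0 → ∀ (R : EuclideanSpace ℝ (Fin 3) ≃ₗᵢ[ℝ] EuclideanSpace ℝ (Fin 3)) (x y : EuclideanSpace ℝ (Fin 3)), x ∈ D → y ∈ D → x ≠ y → H (R '' D) (R x) (R y) = H D x y) ∧ (∀ D : Set (EuclideanSpace ℝ (Fin 3)), IsOpen D ∧ MeasureTheory.volume (frontier D) = 0 → ∀ (c : ℝ), 0 < c → ∀ (x y : EuclideanSpace ℝ (Fin 3)), x ∈ D → y ∈ D → x ≠ y → H ((fun z => c • z) '' D) (c • x) (c • y) = c ^ (-(2 : ℝ) * Δ) * H D x y) := by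
  obtain ⟨Δ, hΔ, hbulk⟩ := h₁
  obtain ⟨r, hconv, hbd, htr, hrot, hdil⟩ := h₂
  have hB := bulk_routeForm hbulk
  refine ⟨Δ, fun D x y => ‖x - y‖ ^ (-(2 * Δ)) * r D x y, hΔ, ?_, ?_, ?_, ?_, ?_⟩
  · -- (i) convergence in every admissible domain: product of the two locally uniform limits
    intro D hD
    set s : Set (Fin 2 → EuclideanSpace ℝ (Fin 3)) := NonCoincident 3 2 ∩ {x | ∀ i, x i ∈ D} with hs
    have hB' : TendstoLocallyUniformlyOn
        (fun (δ : ℝ) (x : Fin 2 → EuclideanSpace ℝ (Fin 3)) => ρ₀ δ ^ 2 * G Set.univ δ 2 x)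
        (fun x => ‖x 0 - x 1‖ ^ (-(2 * Δ))) (nhdsWithin (0 : ℝ) (Set.Ioi 0)) s :=
      hB.mono Set.inter_subset_left
    have hf : ∀ x ∈ s, (𝓝[s] x).IsBoundedUnder (· ≤ ·)
        (fun y : Fin 2 → EuclideanSpace ℝ (Fin 3) => dist (‖y 0 - y 1‖ ^ (-(2 * Δ))) 0) := by
      intro x hx
      have hc : ContinuousWithinAt (fun y : Fin 2 → EuclideanSpace ℝ (Fin 3) => ‖y 0 - y 1‖ ^ (-(2 * Δ))) s x :=
        ((continuousOn_powerLaw Δ).mono Set.inter_subset_left) x hx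
      exact (hc.dist tendsto_const_nhds).isBoundedUnder_le
    have hg : ∀ x ∈ s, (𝓝[s] x).IsBoundedUnder (· ≤ ·)
        (fun y : Fin 2 → EuclideanSpace ℝ (Fin 3) => dist (r D (y 0) (y 1)) 0) := by
      intro x _
      refine Filter.isBoundedUnder_of ⟨1, fun y => ?_⟩
      show dist (r D (y 0) (y 1)) 0 ≤ 1
      rw [Real.dist_eq, sub_zero]
      obtain ⟨h0, h1⟩ := hbd D hD (y 0) (y 1)
      exact abs_le.2 ⟨by linarith, h1⟩
    have hprod := hB'.mul₀_of_isBoundedUnder (hconv D hD) hf hg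
    refine (hprod.congr_inseparable ?_).congr_right ?_
    · filter_upwards [self_mem_nhdsWithin] with δ hδ x _
      refine Inseparable.of_eq ?_
      have hne := (G_univ_two_pos (Set.mem_Ioi.1 hδ) x).ne'
      show ρ₀ δ ^ 2 * G Set.univ δ 2 x * (G D δ 2 x / G Set.univ δ 2 x) = ρ₀ δ ^ 2 * G D δ 2 x
      rw [mul_assoc, ← mul_div_assoc, mul_div_cancel_left₀ _ hne]
    · intro x _
      rfl
  · -- (ii) positivity in full space: the removal ratio of `ℝ³` is `1`
    intro x y hxy
    have hmem : (![x, y] : Fin 2 → EuclideanSpace ℝ (Fin 3)) ∈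
        NonCoincident 3 2 ∩ {x | ∀ i, x i ∈ (Set.univ : Set (EuclideanSpace ℝ (Fin 3)))} :=
      ⟨pair_mem_nonCoincident hxy, fun _ => Set.mem_univ _⟩
    have hr1 : r Set.univ x y = 1 := by
      have h := (hconv Set.univ adm_univ).unique ratio_univ_tendsto hmem
      simpa using h
    show 0 < ‖x - y‖ ^ (-(2 * Δ)) * r Set.univ x y
    rw [hr1, mul_one]
    exact Real.rpow_pos_of_pos (norm_pos_iff.2 (sub_ne_zero.2 hxy)) _
  · -- (iii) translations
    intro D hD v x y hx hy hxy
    show ‖x + v - (y + v)‖ ^ (-(2 * Δ)) * r ((fun z => z + v) '' D) (x + v) (y + v) =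
      ‖x - y‖ ^ (-(2 * Δ)) * r D x y
    rw [htr D hD v x y hx hy hxy, add_sub_add_right_eq_sub]
  · -- (iv) linear isometries
    intro D hD R x y hx hy hxy
    show ‖R x - R y‖ ^ (-(2 * Δ)) * r (R '' D) (R x) (R y) = ‖x - y‖ ^ (-(2 * Δ)) * r D x y
    rw [hrot D hD R x y hx hy hxy, ← R.map_sub, R.norm_map]
  · -- (v) dilations: the factor `c^{-2Δ}` comes from the bulk power law alone
    intro D hD c hc x y hx hy hxy
    show ‖c • x - c • y‖ ^ (-(2 * Δ)) * r ((fun z => c • z) '' D) (c • x) (c • y) =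
      c ^ (-(2 : ℝ) * Δ) * (‖x - y‖ ^ (-(2 * Δ)) * r D x y)
    rw [hdil D hD c hc x y hx hy hxy, ← smul_sub, norm_smul, Real.norm_eq_abs, abs_of_pos hc,
      Real.mul_rpow hc.le (norm_nonneg _), neg_mul, mul_assoc]

/-- **The line concludes the crux BY NAME (skeleton theorem).** `stub_bulkPowerLaw` and `stub_removalRatio`
(the only `sorry`s of this file) composed by the sorry-free assembly `twoPointDomainTheory_of_bulk_of_ratio` give
`Summit.CriticalPhenomena.Ising3DConformalLimit.Theses.MoebiusRestrictionCurrents.TwoPointDomainTheory`; the axiom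
closure of this theorem is the whitelist plus `sorryAx` from the two stubs and nothing else. -/
theorem TwoPointDomainTheory_of :
    Summit.CriticalPhenomena.Ising3DConformalLimit.Theses.MoebiusRestrictionCurrents.TwoPointDomainTheory :=
  crux_iff.2 (twoPointDomainTheory_of_bulk_of_ratio stub_bulkPowerLaw stub_removalRatio)

end Summit.CriticalPhenomena.Ising3DConformalLimit.Cruxes.TwoPointDomainTheory.Birth

end
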